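import Mathlib

/-!
# Finiteness of totally positive integers with bounded weighted trace

Stub S10c of the line `Sketch-ideate-r1-k1` for the crux
`HilbertIntegralOverconvergentIsCongruence`: in a totally real number field `F`, for a totally
positive `α` and any real `c`, only finitely many totally positive algebraic integers `ν` satisfy
`Tr_{F/ℚ}(αν) < c`.

Proof: `Tr(αν) = Σ_τ τ(α) τ(ν)` over the real embeddings `τ` (through `ℂ`, every complex
embedding of a totally real field being real), all summands are positive, so each
`τ(ν) < c / τ(α)`; hence all conjugates of `ν` are bounded and Mathlib's
`NumberField.Embeddings.finite_of_norm_le` (integers with bounded conjugates are finitely many)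
concludes.
-/

set_option linter.dupNamespace false

open scoped NumberField

namespace Summit.Langlands.Langlands.Theorems.HilbertIntegralOverconvergentIsCongruence

open NumberField

/-- The real-valued trace `Tr_{F/ℚ}(x)` of an element of a number field is the sum, over the
`ℚ`-algebra embeddings `σ : F →ₐ[ℚ] ℂ`, of the real parts `(σ x).re`. -/
private theorem trace_real_eq_sum_re (F : Type*) [Field F] [NumberField F] (x : F) :
    ((Algebra.trace ℚ F x : ℚ) : ℝ) = ∑ σ : F →ₐ[ℚ] ℂ, (σ x).re := by
  have h := trace_eq_sum_embeddings ℂ (K := ℚ) (L := F) (x := x)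
  rw [eq_ratCast] at h
  rw [← Complex.ratCast_re, h, Complex.re_sum]

/-- **stub S10c — `stub_finite_totallyPositive_trace_lt` (M; exponent encoding, finite sublevel sets).**  In
a totally real number field `F`, for a totally positive `α` and any real `c`, only finitely many totally
positive algebraic INTEGERS `ν` have `Tr(αν) < c` (each conjugate satisfies `0 < τ(ν) < c/τ(α)`, so `ν` lies
in a bounded subset of the Minkowski space, which meets the lattice `𝓞_F` in a finite set — Mathlib
`NumberField.Embeddings.finite_of_norm_le`, integers with bounded conjugates). [folklore] -/
theorem stub_finite_totallyPositive_trace_lt (F : Type*) [Field F] [NumberField F]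
    [NumberField.IsTotallyReal F] (α : F) (hα : ∀ τ : F →+* ℝ, 0 < τ α) (c : ℝ) :
    {ν : 𝓞 F | (∀ τ : F →+* ℝ, 0 < τ (ν : F)) ∧ ((Algebra.trace ℚ F (α * ν) : ℚ) : ℝ) < c}.Finite := by
  classical
  -- a uniform bound for the conjugates of the members of the set
  set B : ℝ := ∑ τ : F →+* ℝ, |c| / τ α with hB
  -- key inequality: every real conjugate of a member `ν` is at most `B`
  have key : ∀ ν : 𝓞 F, (∀ τ : F →+* ℝ, 0 < τ (ν : F)) →
      ((Algebra.trace ℚ F (α * ν) : ℚ) : ℝ) < c → ∀ τ : F →+* ℝ, τ (ν : F) ≤ B := by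
    intro ν hpos htr τ
    -- the `ℚ`-algebra embedding into `ℂ` attached to `τ`
    let σ₀ : F →ₐ[ℚ] ℂ := (Complex.ofRealHom.comp τ).toRatAlgHom
    have hσ₀ : ∀ y : F, (σ₀ y).re = τ y := fun _ => rfl
    -- every summand of the trace is non-negative (indeed positive)
    have hterm : ∀ σ : F →ₐ[ℚ] ℂ, 0 ≤ (σ (α * ν)).re := by
      intro σ
      have hr := IsTotallyReal.complexEmbedding_isReal (σ : F →+* ℂ)
      have e : (σ (α * (ν : F))).re = hr.embedding α * hr.embedding (ν : F) := by
        rw [← map_mul]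
        rfl
      rw [e]
      exact (mul_pos (hα _) (hpos _)).le
    have hle : τ α * τ (ν : F) ≤ ((Algebra.trace ℚ F (α * ν) : ℚ) : ℝ) := by
      rw [trace_real_eq_sum_re, ← map_mul, ← hσ₀]
      exact Finset.single_le_sum (f := fun σ : F →ₐ[ℚ] ℂ => (σ (α * ν)).re)
        (fun σ _ => hterm σ) (Finset.mem_univ σ₀)
    have h1 : τ α * τ (ν : F) ≤ |c| := (hle.trans htr.le).trans (le_abs_self c)
    have h2 : τ (ν : F) ≤ |c| / τ α := by
      rw [le_div_iff₀ (hα τ), mul_comm]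
      exact h1
    refine h2.trans ?_
    exact Finset.single_le_sum (f := fun τ' : F →+* ℝ => |c| / τ' α)
      (fun τ' _ => div_nonneg (abs_nonneg c) (hα τ').le) (Finset.mem_univ τ)
  -- containment in the (finite) set of algebraic integers with bounded conjugates
  refine Set.Finite.of_finite_image (f := (algebraMap (𝓞 F) F))
    ((Embeddings.finite_of_norm_le F ℂ B).subset ?_) RingOfIntegers.coe_injective.injOn
  rintro _ ⟨ν, ⟨hpos, htr⟩, rfl⟩
  refine ⟨RingOfIntegers.isIntegral_coe ν, fun φ => ?_⟩
  have hr := IsTotallyReal.complexEmbedding_isReal φ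
  rw [← RingOfIntegers.coe_eq_algebraMap, ← hr.coe_embedding_apply, Complex.norm_real,
    Real.norm_eq_abs, abs_of_pos (hpos hr.embedding)]
  exact key ν hpos htr hr.embedding

end Summit.Langlands.Langlands.Theorems.HilbertIntegralOverconvergentIsCongruence
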